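import Mathlib
import HarnessLib
import Summits.NavierStokesRegularity.NavierStokesRegularity.Theorems.LocalVelCompTubeDoorAxisymOffAxis

/-!
# The door family under a ONE-PARAMETER FAMILY OF SYMMETRIES moving the point: local Type I ⇒ backward bounded
# (generic form of the off-axis-axisymmetric and helical cases; corollary: translation-invariant «2½-D» flows)

Cell ns-regularity-ideate, seat p6 (route-directed support for the door family of LADDER-NS N0; abstracts the common
mechanism of `…LocalVelCompTubeDoorAxisymOffAxis` and `…LocalVelCompTubeDoorHelical`).  Let the classical Leray–Hopf
flow `u` be EQUIVARIANT under a one-parameter family of maps `g θ` with «linear parts» `Λ θ` along rays from `x₀` and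
`L θ` on values — `u(t, g θ x) = L θ (u(t, x))`, `g θ (x₀ + a • y) = g θ x₀ + a • Λ θ y`, `L θ (a • w) = a • L θ w` —
with `Λ θ → id`, `L θ → id` jointly continuously as `θ → 0`, and suppose the ORBIT of `x₀` MOVES: `θ ↦ g θ x₀` has a
derivative `ξ₀ ≠ 0` at `θ = 0` (and `g 0 x₀ = x₀`).  Then along `θⱼ = λⱼ l` the maps act on the zoom chart at `x₀` as
translations in the limit (`g θⱼ (x₀ + λⱼ y) = x₀ + λⱼ yⱼ`, `yⱼ → y + l • ξ₀`), so the DIAGONAL velocity zoom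
(`localPointZoomVelSlicesDiag`) yields a blow-up profile translation-invariant along `ξ₀` on every slice — a settled
stratum — and `u` is backward bounded at `(x₀, T)` whenever it is locally Type I there:

* `tendsto_slope_smul` — `λⱼ⁻¹ • (f (λⱼ l) − f 0) → l • f'` for `HasDerivAt f f' 0`, `λⱼ → 0⁺`;
* `isBackwardBoundedAt_of_localTypeI_equivariant` — the generic theorem;
* `isBackwardBoundedAt_of_localTypeI_translationInvariant` — COROLLARY: a flow invariant under the translations along
  a fixed `e ≠ 0` («2½-dimensional», `u(t, x + θ e) = u(t, x)`) is backward bounded at every locally Type-I point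
  (in print: such flows reduce to 2D Navier–Stokes with a passively advected third component and are globally regular).

WHAT THIS IS NOT: not a claim about Navier–Stokes regularity (Clay A) — S-restricted cases of the door family under
continuous symmetries, inside printed regimes; new as door-vocabulary kernel statements (bears_on LADDER-NS N0).
-/

noncomputable section

-- the summit and its single sub-problem share the name (CONVENTIONS §1), as in every Theorems file
set_option linter.dupNamespace false

namespace Summit.NavierStokesRegularity.NavierStokesRegularity.Theorems.LocalVelCompTubeDoorEquivariantFamily

open MeasureTheory Set Function Filter Topology TopologicalSpace Metric
open scoped RealInnerProductSpace InnerProductSpace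
open Literature.Analysis Literature.Analysis.FluidPDE
open Summit.NavierStokesRegularity.NavierStokesRegularity.Theorems.LocalVelCompTubeDoorLocalPointZoomVelSlicesDiag
open Summit.NavierStokesRegularity.NavierStokesRegularity.Theorems.PoloidalWindowDoorPoloidalWindowRigidityFlat
open Summit.NavierStokesRegularity.NavierStokesRegularity.Theorems.PoloidalWindowDoorPoloidalWindowRigidityOneSlice

/-- Difference quotients along `θⱼ = λⱼ l`, `λⱼ → 0⁺`: `λⱼ⁻¹ • (f (λⱼ l) − f 0) → l • f'` when `f` has derivative
`f'` at `0`. -/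
theorem tendsto_slope_smul {f : ℝ → EuclideanSpace ℝ (Fin 3)} {f' : EuclideanSpace ℝ (Fin 3)} (hf : HasDerivAt f f' 0)
    {lam : ℕ → ℝ} (hlam : ∀ j, 0 < lam j) (hlam0 : Tendsto lam atTop (𝓝 0)) (l : ℝ) :
    Tendsto (fun j => (lam j)⁻¹ • (f (lam j * l) - f 0)) atTop (𝓝 (l • f')) := by
  by_cases hl : l = 0
  · subst hl
    simp only [mul_zero, sub_self, smul_zero, zero_smul]
    exact tendsto_const_nhds
  have hθ : Tendsto (fun j => lam j * l) atTop (𝓝[≠] 0) := by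
    refine tendsto_nhdsWithin_of_tendsto_nhds_of_eventually_within _ ?_ (Eventually.of_forall fun j => ?_)
    · simpa using hlam0.mul_const l
    · exact mul_ne_zero (hlam j).ne' hl
  have hcomp := ((hf.tendsto_slope_zero).comp hθ).const_smul l
  refine hcomp.congr fun j => ?_
  simp only [Function.comp_def, zero_add, smul_smul]
  congr 1
  field_simp [(hlam j).ne', hl]

/-- **Local Type I + equivariance under a one-parameter family of symmetries whose orbit MOVES `x₀` ⇒ backward bounded
at `(x₀, T)`.**  Hypotheses: `u(t, g θ x) = L θ (u(t,x))` for all `t, θ, x`; `g θ` is affine along rays from `x₀` with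
«linear part» `Λ θ` (`g θ (x₀ + a • y) = g θ x₀ + a • Λ θ y`); `L θ` is homogeneous; `Λ θ y → y` and `L θ w → w` jointly
continuously as `θ → 0`; `g 0 x₀ = x₀` and `θ ↦ g θ x₀` has derivative `ξ₀ ≠ 0` at `0`. -/
theorem isBackwardBoundedAt_of_localTypeI_equivariant
    (ν T : ℝ) (hν : 0 < ν) (hT : 0 < T) (u : ℝ → EuclideanSpace ℝ (Fin 3) → EuclideanSpace ℝ (Fin 3))
    (p : ℝ → EuclideanSpace ℝ (Fin 3) → ℝ)
    (hcl : IsClassicalNSSolutionOn (Set.Ico 0 T) ν 0 u p) (hLH : IsLerayHopfOn T ν 0 (u 0) u)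
    (hdec : HasRapidSpatialDecay (u 0))
    (x₀ : EuclideanSpace ℝ (Fin 3)) (ρ M : ℝ) (hρ : 0 < ρ)
    (hM : ∀ t ∈ Set.Ico 0 T, T - ρ ^ 2 < t → ∀ x ∈ Metric.ball x₀ ρ, ‖u t x‖ * Real.sqrt (ν * (T - t)) ≤ M)
    (g Λ L : ℝ → EuclideanSpace ℝ (Fin 3) → EuclideanSpace ℝ (Fin 3))
    (hequiv : ∀ (t θ : ℝ) (x : EuclideanSpace ℝ (Fin 3)), u t (g θ x) = L θ (u t x))
    (hg : ∀ (θ a : ℝ) (y : EuclideanSpace ℝ (Fin 3)), g θ (x₀ + a • y) = g θ x₀ + a • Λ θ y)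
    (hL : ∀ (θ a : ℝ) (w : EuclideanSpace ℝ (Fin 3)), L θ (a • w) = a • L θ w)
    (hΛc : ∀ y : EuclideanSpace ℝ (Fin 3), Tendsto (uncurry Λ) (𝓝 ((0 : ℝ), y)) (𝓝 y))
    (hLc : ∀ w : EuclideanSpace ℝ (Fin 3), Tendsto (uncurry L) (𝓝 ((0 : ℝ), w)) (𝓝 w))
    (hg0 : g 0 x₀ = x₀) {ξ₀ : EuclideanSpace ℝ (Fin 3)} (hξ : HasDerivAt (fun θ => g θ x₀) ξ₀ 0) (hξ₀ : ξ₀ ≠ 0) :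
    IsBackwardBoundedAt u T x₀ := by
  by_contra hnot
  obtain ⟨C, v, lam, hlam, hlam0, ⟨hrate, hcont, hmild, hdiv⟩, hsing, hconv⟩ :=
    localPointZoomVelSlicesDiag ν T hν hT u p hcl hLH hdec x₀ ρ M hρ hM hnot
  have htr : ∀ s < 0, ∀ (y : EuclideanSpace ℝ (Fin 3)) (l : ℝ), v s (y + l • ξ₀) = v s y := by
    intro s hs y l
    set θ : ℕ → ℝ := fun j => lam j * l with hθdef
    set yseq : ℕ → EuclideanSpace ℝ (Fin 3) := fun j => (lam j)⁻¹ • (g (θ j) x₀ - x₀) + Λ (θ j) y with hyseqdef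
    have hθ0 : Tendsto θ atTop (𝓝 0) := by simpa [hθdef] using hlam0.mul_const l
    have hΛy : Tendsto (fun j => Λ (θ j) y) atTop (𝓝 y) := by
      have hc := (hΛc y).comp (hθ0.prodMk_nhds tendsto_const_nhds)
      simpa [Function.comp_def] using hc
    have hyseq : Tendsto yseq atTop (𝓝 (y + l • ξ₀)) := by
      have hsl := tendsto_slope_smul hξ hlam hlam0 l
      simp only [hg0] at hsl
      have hc := hsl.add hΛy
      rw [add_comm (l • ξ₀) y] at hc
      simpa [hyseqdef, hθdef] using hc
    have hpts : ∀ j, x₀ + lam j • yseq j = g (θ j) (x₀ + lam j • y) := by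
      intro j
      have hl0 : lam j ≠ 0 := (hlam j).ne'
      rw [hg, hyseqdef]
      simp only [smul_add, smul_smul, mul_inv_cancel₀ hl0, one_smul]
      abel
    have h1 : Tendsto (fun j => (lam j / ν) • u (T + lam j ^ 2 * s / ν) (x₀ + lam j • yseq j)) atTop
        (𝓝 (v s (y + l • ξ₀))) := hconv s hs (y + l • ξ₀) yseq hyseq
    have h2 : Tendsto (fun j => L (θ j) ((lam j / ν) • u (T + lam j ^ 2 * s / ν) (x₀ + lam j • y))) atTop
        (𝓝 (v s y)) := by
      have hc := (hLc (v s y)).comp ((hθ0).prodMk_nhds (hconv s hs y (fun _ => y) tendsto_const_nhds))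
      simpa [Function.comp_def] using hc
    have heq : (fun j => (lam j / ν) • u (T + lam j ^ 2 * s / ν) (x₀ + lam j • yseq j)) =
        fun j => L (θ j) ((lam j / ν) • u (T + lam j ^ 2 * s / ν) (x₀ + lam j • y)) := by
      funext j
      rw [hpts j, hequiv _ (θ j) (x₀ + lam j • y), hL]
    rw [heq] at h1
    exact tendsto_nhds_unique h1 h2
  exact (nonflatLiouville_of_translate_eq_slice hrate hcont hmild hdiv (s := -1) (by norm_num) hξ₀
    (fun y l => htr (-1) (by norm_num) y l)) hsing

/-- **«2½-dimensional» flows: invariant under the translations along a fixed `e ≠ 0` ⇒ backward bounded at every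
locally Type-I point** (the generic theorem with `g θ x = x + θ • e`, `Λ θ = L θ = id`, `ξ₀ = e`). -/
theorem isBackwardBoundedAt_of_localTypeI_translationInvariant
    (ν T : ℝ) (hν : 0 < ν) (hT : 0 < T) (u : ℝ → EuclideanSpace ℝ (Fin 3) → EuclideanSpace ℝ (Fin 3))
    (p : ℝ → EuclideanSpace ℝ (Fin 3) → ℝ)
    (hcl : IsClassicalNSSolutionOn (Set.Ico 0 T) ν 0 u p) (hLH : IsLerayHopfOn T ν 0 (u 0) u)
    (hdec : HasRapidSpatialDecay (u 0)) {e : EuclideanSpace ℝ (Fin 3)} (he : e ≠ 0)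
    (hinv : ∀ (t θ : ℝ) (x : EuclideanSpace ℝ (Fin 3)), u t (x + θ • e) = u t x)
    (x₀ : EuclideanSpace ℝ (Fin 3)) (ρ M : ℝ) (hρ : 0 < ρ)
    (hM : ∀ t ∈ Set.Ico 0 T, T - ρ ^ 2 < t → ∀ x ∈ Metric.ball x₀ ρ, ‖u t x‖ * Real.sqrt (ν * (T - t)) ≤ M) :
    IsBackwardBoundedAt u T x₀ := by
  refine isBackwardBoundedAt_of_localTypeI_equivariant ν T hν hT u p hcl hLH hdec x₀ ρ M hρ hM
    (fun θ x => x + θ • e) (fun _ y => y) (fun _ w => w) (fun t θ x => hinv t θ x)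
    (fun θ a y => by abel) (fun _ _ _ => rfl) (fun y => ?_) (fun w => ?_) (by simp) (ξ₀ := e) ?_ he
  · exact (continuous_snd.tendsto ((0 : ℝ), y))
  · exact (continuous_snd.tendsto ((0 : ℝ), w))
  · simpa using ((hasDerivAt_id (0 : ℝ)).smul_const e).const_add x₀

end Summit.NavierStokesRegularity.NavierStokesRegularity.Theorems.LocalVelCompTubeDoorEquivariantFamily

end
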